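import Summits.QuantumFields.BalabanUV.Beta.D1BFx.GramWeightJetsMixed
import Summits.QuantumFields.BalabanUV.Beta.D1BFx.ColourLift

/-!
# `BalabanUV.Beta.D1BFx.GramWeightColourLift` — road «BF-x» for binder row D1, slot (K), X₃(ii) ROUTE T, brick **K-TA4C «THE ANTISYMMETRIC
# (COLOUR) LIFT OF THE JET IDENTITY»** (`HOME/b2b-balaban-beta-d1-p2/K-ASSEMBLY-SPEC-v2.md` v2.2, owner FINDING F-g6-1), PART 2 — THE LIFTED
# AND THE STRIPPED IDENTITY: K-TA4G's Gram-form jet identity (PART 2c `mixedVar_gramTransfer_jets`, shape (R2)) at the colour-lifted data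
# `1⊗K₀, c⊗kₛ, (c·c)⊗kₛₜ, …` from the COLOURLESS one-sided Ward letters + the parity types, and — all traces carrying the uniform factor
# `tr(c·c)` — the colour-STRIPPED identity for the signed bordered jets `[[k, −qᵀ],[q, 0]]` and the twisted Gram jets (`c = cgen`, `tr C² = −2`)

HONEST DEPENDENCY (cell records, verbatim): «continuum YM on T⁴ ⇐ BetaPertH ∧ nine spine estimates (0/9 proved); BetaPertH ⇐ (D1) ∧ (D4) ∧
CAP+tail; G-an2-4 gates asym, D1 and NE2/3/4.»  HONEST FRAMING (cell contract, verbatim): «discharging `BetaPertH` makes Bałaban's UV stability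
UNCONDITIONAL — a real constructive-QFT result; it is NOT the continuum limit and NOT the Clay problem.»  THIS MODULE DISCHARGES NOTHING of (K),
of D1 or of the wall: [folklore] finite-dimensional algebra over PART 1 `ColourLift` (the lift lemmas, BY NAME) and K-TA4G PART 2b∕2c
`GramWeightJets`∕`GramWeightJetsMixed` (`gram₀∕₁∕₂`, `gramMix`, `mixedVar_gramTransfer_jets`).  [our object] data: the twisted Gram jets `tgram₁`,
`tgramMix` and the signed bordered jets `tj`, `tj₂` (plain abbreviations).  No `def … : Prop`, nothing cited, no wall binder instantiated,
0 sorry.  NOT D1, NOT BetaPertH, NOT continuum, NOT Clay.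

ABSOLUTE RULE (cell charter, verbatim): «No internally-minted statement may enter as a cited fact. Every hypothesis is either kernel-proved in this
package or a verbatim quotation of a PUBLISHED theorem with page reference. The manuscript(s) under audit are NOT citable for their own disputed
steps — they are the thing under adjudication; programme-internal (2001/route/tribunal) claims are never citable.»

CONTENT:
* §1 [our object] `tgram₁ W₀ w B₀ b := −wᵀB₀W₀ + W₀ᵀbW₀ + W₀ᵀB₀w`, `tgramMix` (nine terms, sign `−` exactly on the terms with ONE transposed odd jet);
  [folklore] the ten lift patterns `lift_ijk` (`(cⁱ⊗a)ᵀ(cʲ⊗b)(cᵏ⊗d) = ±(c^{i+j+k} ⊗ aᵀbd)`), **`gram₀_lift`**, **`gram₁_lift`**, **`gramMix_lift`** (`cᵀ = −c`).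
* §2 [folklore] **`mixedVar_gramTransfer_lift`** — K-TA4G at the lifted data, hypotheses = COLOURLESS one-sided letters (a0)…(bₛₜ) + parity types
  (`K₀ᵀ = K₀`; `kₛ`, `kₜ` antisymmetric; `kₛₛ`, `kₜₜ`, `kₛₜ` symmetric) + `det(τW₀)`, `det(τ′₀W₀)`, `det A₀`, `det kkt K₀ [Q₀;τ] ≠ 0`; any antisymmetric `c`.
* §3 [our object] `tj ρ k q := [[k, −[q;0]ᵀ],[[q;0], 0]]`, `tj₂ k q := [[k, −qᵀ],[q, 0]]`; [folklore] the re-indexing ∕ Kronecker form of every lifted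
  argument (`kkt_lift₁∕₂`, `kktN_lift₀∕₁∕₂`, `gramPhi_lift₀∕₁∕Mix`, `lift_mul`); **`mixedVar_gramTransfer_stripped_mul`** (`tr(c·c) ×` both sides)
  and **`mixedVar_gramTransfer_stripped`** (`c = cgen`, factor `−2` cancelled): the c-FREE identity
  `mixedVar M (tj kₛ qₛ) (tj kₜ qₜ) (kkt kₛₜ [qₛₜ;0]) + mixedVar Φ₀ (tgram₁ …) (tgram₁ …) (tgramMix …) = mixedVar N₀ (tj₂ (kₛ + b̃ₛ) qₛ) (tj₂ (kₜ + b̃ₜ) qₜ)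
  (kkt (kₛₜ + b̃ₛₜ) qₛₜ) + 2·mixedVar (τW₀) (τwₛ) (τwₜ) (τwₛₜ)`, `B₀ = gram₀ τ′₀ A₀`, `b̃ₛ = tgram₁ τ′₀ tₛ A₀ Aₛ`, `b̃ₛₜ = tgramMix τ′ A`.
NOT HERE (honest): the `hessT`∕packed-corner read-out of the signed first jets (`tj = kkt·diag(1,−1,·)`; the `D`-placement of F-g6-1 belongs
to TB5's dictionary step), the torus instantiation (TB3∕TB4∕TB5).
Provenance: G-an2-4 formalisation swarm leaf seat `b2b-balaban-gan24-formalise-leaf-03` gen 44 (cross-lane), claim «K-TA4C» PART 2, 2026-08-20.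
-/

noncomputable section

namespace Summit.QuantumFields.BalabanUV.Beta.D1BFx.GramWeightColourLift

open Matrix
open scoped Kronecker
open Literature.MathematicalPhysics.QuantumFieldTheory.Balaban1983to89.Beta.Composition (kkt)
open Summit.QuantumFields.BalabanUV.Beta.D1BFx.SliceTransferJetsMixed (mixedVar)
open Summit.QuantumFields.BalabanUV.Beta.D1BFx.MixedVarPackedHess (hessT)
open Summit.QuantumFields.BalabanUV.Beta.D1BFx.GramWeightJets (gram₀ gram₁ gram₂)
open Summit.QuantumFields.BalabanUV.Beta.D1BFx.GramWeightJetsMixed (gramMix mixedVar_gramTransfer_jets)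
open Summit.QuantumFields.BalabanUV.Beta.D1BFx.ColourLift

/-! ## §1 The twisted Gram jets and the lift of the Gram jet polynomials -/

section Gram

variable {l ι κ : Type*} [Fintype l] [Fintype ι] [DecidableEq l]

/-- [our object] THE TWISTED FIRST GRAM JET (the stripped first jet of `WᵀBW` when the first jets carry one antisymmetric colour factor):
`−wᵀB₀W₀ + W₀ᵀbW₀ + W₀ᵀB₀w`. -/
def tgram₁ (W₀ w : Matrix ι κ ℝ) (B₀ b : Matrix ι ι ℝ) : Matrix κ κ ℝ := -(wᵀ * B₀ * W₀) + W₀ᵀ * b * W₀ + W₀ᵀ * B₀ * w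

/-- [our object] THE TWISTED MIXED GRAM JET (signs on the terms with exactly one transposed odd jet). -/
def tgramMix (W₀ wₛ wₜ wₛₜ : Matrix ι κ ℝ) (B₀ bₛ bₜ bₛₜ : Matrix ι ι ℝ) : Matrix κ κ ℝ :=
  wₛₜᵀ * B₀ * W₀ + -(wₛᵀ * bₜ * W₀) + -(wₜᵀ * bₛ * W₀) + W₀ᵀ * bₛₜ * W₀ + -(wₛᵀ * B₀ * wₜ) + -(wₜᵀ * B₀ * wₛ)
    + W₀ᵀ * bₛ * wₜ + W₀ᵀ * bₜ * wₛ + W₀ᵀ * B₀ * wₛₜ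

variable {c : Matrix l l ℝ}

/-- [folklore] Lift pattern `(1⊗A)ᵀ(1⊗B)(1⊗D) = 1 ⊗ (AᵀBD)`. -/
theorem lift_000 (A D : Matrix ι κ ℝ) (B : Matrix ι ι ℝ) :
    ((1 : Matrix l l ℝ) ⊗ₖ A)ᵀ * ((1 : Matrix l l ℝ) ⊗ₖ B) * ((1 : Matrix l l ℝ) ⊗ₖ D) = (1 : Matrix l l ℝ) ⊗ₖ (Aᵀ * B * D) := by
  rw [kronecker_transpose', Matrix.transpose_one, ← Matrix.mul_kronecker_mul, ← Matrix.mul_kronecker_mul, Matrix.one_mul, Matrix.one_mul]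

/-- [folklore] Lift pattern `(c⊗a)ᵀ(1⊗B)(1⊗D) = −(c ⊗ (aᵀBD))` (`cᵀ = −c`). -/
theorem lift_100 (hc : cᵀ = -c) (a D : Matrix ι κ ℝ) (B : Matrix ι ι ℝ) :
    (c ⊗ₖ a)ᵀ * ((1 : Matrix l l ℝ) ⊗ₖ B) * ((1 : Matrix l l ℝ) ⊗ₖ D) = -(c ⊗ₖ (aᵀ * B * D)) := by
  rw [kronecker_transpose', hc, neg_kronecker, Matrix.neg_mul, Matrix.neg_mul, ← Matrix.mul_kronecker_mul, ← Matrix.mul_kronecker_mul,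
    Matrix.mul_one, Matrix.mul_one]

/-- [folklore] Lift pattern `(1⊗A)ᵀ(c⊗b)(1⊗D) = c ⊗ (AᵀbD)`. -/
theorem lift_010 (A D : Matrix ι κ ℝ) (b : Matrix ι ι ℝ) :
    ((1 : Matrix l l ℝ) ⊗ₖ A)ᵀ * (c ⊗ₖ b) * ((1 : Matrix l l ℝ) ⊗ₖ D) = c ⊗ₖ (Aᵀ * b * D) := by
  rw [kronecker_transpose', Matrix.transpose_one, ← Matrix.mul_kronecker_mul, ← Matrix.mul_kronecker_mul, Matrix.one_mul, Matrix.mul_one]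

/-- [folklore] Lift pattern `(1⊗A)ᵀ(1⊗B)(c⊗d) = c ⊗ (AᵀBd)`. -/
theorem lift_001 (A d : Matrix ι κ ℝ) (B : Matrix ι ι ℝ) :
    ((1 : Matrix l l ℝ) ⊗ₖ A)ᵀ * ((1 : Matrix l l ℝ) ⊗ₖ B) * (c ⊗ₖ d) = c ⊗ₖ (Aᵀ * B * d) := by
  rw [kronecker_transpose', Matrix.transpose_one, ← Matrix.mul_kronecker_mul, ← Matrix.mul_kronecker_mul, Matrix.one_mul, Matrix.one_mul]

/-- [folklore] Lift pattern `((c·c)⊗a₂)ᵀ(1⊗B)(1⊗D) = (c·c) ⊗ (a₂ᵀBD)` (`cᵀ = −c`). -/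
theorem lift_200 (hc : cᵀ = -c) (a D : Matrix ι κ ℝ) (B : Matrix ι ι ℝ) :
    ((c * c) ⊗ₖ a)ᵀ * ((1 : Matrix l l ℝ) ⊗ₖ B) * ((1 : Matrix l l ℝ) ⊗ₖ D) = (c * c) ⊗ₖ (aᵀ * B * D) := by
  rw [kronecker_transpose', sq_transpose hc, ← Matrix.mul_kronecker_mul, ← Matrix.mul_kronecker_mul, Matrix.mul_one, Matrix.mul_one]

/-- [folklore] Lift pattern `(c⊗a)ᵀ(c⊗b)(1⊗D) = −((c·c) ⊗ (aᵀbD))` (`cᵀ = −c`). -/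
theorem lift_110 (hc : cᵀ = -c) (a D : Matrix ι κ ℝ) (b : Matrix ι ι ℝ) :
    (c ⊗ₖ a)ᵀ * (c ⊗ₖ b) * ((1 : Matrix l l ℝ) ⊗ₖ D) = -((c * c) ⊗ₖ (aᵀ * b * D)) := by
  rw [kronecker_transpose', hc, neg_kronecker, Matrix.neg_mul, Matrix.neg_mul, ← Matrix.mul_kronecker_mul, ← Matrix.mul_kronecker_mul,
    Matrix.mul_one]

/-- [folklore] Lift pattern `(c⊗a)ᵀ(1⊗B)(c⊗d) = −((c·c) ⊗ (aᵀBd))` (`cᵀ = −c`). -/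
theorem lift_101 (hc : cᵀ = -c) (a d : Matrix ι κ ℝ) (B : Matrix ι ι ℝ) :
    (c ⊗ₖ a)ᵀ * ((1 : Matrix l l ℝ) ⊗ₖ B) * (c ⊗ₖ d) = -((c * c) ⊗ₖ (aᵀ * B * d)) := by
  rw [kronecker_transpose', hc, neg_kronecker, Matrix.neg_mul, Matrix.neg_mul, ← Matrix.mul_kronecker_mul, ← Matrix.mul_kronecker_mul,
    Matrix.mul_one]

/-- [folklore] Lift pattern `(1⊗A)ᵀ((c·c)⊗b₂)(1⊗D) = (c·c) ⊗ (Aᵀb₂D)`. -/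
theorem lift_020 (A D : Matrix ι κ ℝ) (b : Matrix ι ι ℝ) :
    ((1 : Matrix l l ℝ) ⊗ₖ A)ᵀ * ((c * c) ⊗ₖ b) * ((1 : Matrix l l ℝ) ⊗ₖ D) = (c * c) ⊗ₖ (Aᵀ * b * D) := by
  rw [kronecker_transpose', Matrix.transpose_one, ← Matrix.mul_kronecker_mul, ← Matrix.mul_kronecker_mul, Matrix.one_mul, Matrix.mul_one]

/-- [folklore] Lift pattern `(1⊗A)ᵀ(c⊗b)(c⊗d) = (c·c) ⊗ (Aᵀbd)`. -/
theorem lift_011 (A d : Matrix ι κ ℝ) (b : Matrix ι ι ℝ) :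
    ((1 : Matrix l l ℝ) ⊗ₖ A)ᵀ * (c ⊗ₖ b) * (c ⊗ₖ d) = (c * c) ⊗ₖ (Aᵀ * b * d) := by
  rw [kronecker_transpose', Matrix.transpose_one, ← Matrix.mul_kronecker_mul, ← Matrix.mul_kronecker_mul, Matrix.one_mul]

/-- [folklore] Lift pattern `(1⊗A)ᵀ(1⊗B)((c·c)⊗d₂) = (c·c) ⊗ (AᵀBd₂)`. -/
theorem lift_002 (A d : Matrix ι κ ℝ) (B : Matrix ι ι ℝ) :
    ((1 : Matrix l l ℝ) ⊗ₖ A)ᵀ * ((1 : Matrix l l ℝ) ⊗ₖ B) * ((c * c) ⊗ₖ d) = (c * c) ⊗ₖ (Aᵀ * B * d) := by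
  rw [kronecker_transpose', Matrix.transpose_one, ← Matrix.mul_kronecker_mul, ← Matrix.mul_kronecker_mul, Matrix.one_mul, Matrix.one_mul]

/-- [folklore] **ZEROTH GRAM JET LIFTS PLAINLY**: `gram₀ (1⊗W) (1⊗B) = 1 ⊗ gram₀ W B`. -/
theorem gram₀_lift (W₀ : Matrix ι κ ℝ) (B₀ : Matrix ι ι ℝ) :
    gram₀ ((1 : Matrix l l ℝ) ⊗ₖ W₀) ((1 : Matrix l l ℝ) ⊗ₖ B₀) = (1 : Matrix l l ℝ) ⊗ₖ gram₀ W₀ B₀ := by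
  rw [gram₀, gram₀, lift_000]

/-- [folklore] **FIRST GRAM JET LIFTS WITH A TWIST**: `gram₁ (1⊗W₀) (c⊗w) (1⊗B₀) (c⊗b) = c ⊗ tgram₁ W₀ w B₀ b` (`cᵀ = −c`). -/
theorem gram₁_lift (hc : cᵀ = -c) (W₀ w : Matrix ι κ ℝ) (B₀ b : Matrix ι ι ℝ) :
    gram₁ ((1 : Matrix l l ℝ) ⊗ₖ W₀) (c ⊗ₖ w) ((1 : Matrix l l ℝ) ⊗ₖ B₀) (c ⊗ₖ b) = c ⊗ₖ tgram₁ W₀ w B₀ b := by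
  rw [gram₁, Matrix.add_mul, lift_100 hc, lift_010, lift_001, tgram₁, Matrix.kronecker_add, Matrix.kronecker_add, kronecker_neg]

/-- [folklore] **MIXED GRAM JET LIFTS WITH THE TWIST**: `gramMix (lifted) = (c·c) ⊗ tgramMix` (`cᵀ = −c`). -/
theorem gramMix_lift (hc : cᵀ = -c) (W₀ wₛ wₜ wₛₜ : Matrix ι κ ℝ) (B₀ bₛ bₜ bₛₜ : Matrix ι ι ℝ) :
    gramMix ((1 : Matrix l l ℝ) ⊗ₖ W₀) (c ⊗ₖ wₛ) (c ⊗ₖ wₜ) ((c * c) ⊗ₖ wₛₜ)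
        ((1 : Matrix l l ℝ) ⊗ₖ B₀) (c ⊗ₖ bₛ) (c ⊗ₖ bₜ) ((c * c) ⊗ₖ bₛₜ)
      = (c * c) ⊗ₖ tgramMix W₀ wₛ wₜ wₛₜ B₀ bₛ bₜ bₛₜ := by
  rw [gramMix, lift_200 hc, lift_110 hc, lift_110 hc, lift_020, lift_101 hc, lift_101 hc, lift_011, lift_011, lift_002, tgramMix]
  simp only [Matrix.kronecker_add, kronecker_neg]

end Gram


/-! ## §2 K-TA4G at the lifted data -/

section Lift

variable {l ν μ ρ : Type*} [Fintype l] [Fintype ν] [Fintype μ] [Fintype ρ] [DecidableEq l] [DecidableEq ν] [DecidableEq μ] [DecidableEq ρ]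
variable {c : Matrix l l ℝ}

/-- [folklore] **K-TA4G (mixed functionals, shape (R2)) AT THE COLOUR-LIFTED DATA.**  COLOURLESS typed data: `K₀` symmetric, first form jets
`kₛ`, `kₜ` antisymmetric, second form jets `kₛₛ`, `kₜₜ`, `kₛₜ` symmetric; constraint, co-frame, `A`- and gauge-basis jets untyped; constant comb rows
`τ`.  HYPOTHESES = the COLOURLESS ONE-SIDED letters (a0), (aₛ), (aₜ), (aₛₛ), (aₜₜ), (aₛₜ), (b0)…(bₛₜ) + the parity types + the four `det ≠ 0`.
CONCLUSION = `mixedVar_gramTransfer_jets` for the lifted matrices over `(l×ν, l×μ, l×ρ)`: zeroth jets `1 ⊗ ·`, first jets `c ⊗ ·`, second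
jets `(c·c) ⊗ ·`, for ANY antisymmetric colour matrix `c` (`cᵀ = −c`; on the road `c = cgen`). -/
theorem mixedVar_gramTransfer_lift (hc : cᵀ = -c)
    (K₀ kₛ kₜ kₛₛ kₜₜ kₛₜ : Matrix ν ν ℝ) (Q₀ qₛ qₜ qₛₛ qₜₜ qₛₜ : Matrix μ ν ℝ)
    (T₀ tₛ tₜ tₛₛ tₜₜ tₛₜ : Matrix ρ ν ℝ) (A₀ Aₛ Aₜ Aₛₛ Aₜₜ Aₛₜ : Matrix ρ ρ ℝ) (W₀ wₛ wₜ wₛₛ wₜₜ wₛₜ : Matrix ν ρ ℝ) (τ : Matrix ρ ν ℝ)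
    (hK₀ : K₀ᵀ = K₀) (hkₛ : kₛᵀ = -kₛ) (hkₜ : kₜᵀ = -kₜ) (hkₛₛ : kₛₛᵀ = kₛₛ) (hkₜₜ : kₜₜᵀ = kₜₜ) (hkₛₜ : kₛₜᵀ = kₛₜ)
    (a0 : K₀ * W₀ = 0) (aₛ : kₛ * W₀ + K₀ * wₛ = 0) (aₜ : kₜ * W₀ + K₀ * wₜ = 0)
    (aₛₛ : kₛₛ * W₀ + (2 : ℝ) • (kₛ * wₛ) + K₀ * wₛₛ = 0) (aₜₜ : kₜₜ * W₀ + (2 : ℝ) • (kₜ * wₜ) + K₀ * wₜₜ = 0)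
    (aₛₜ : kₛₜ * W₀ + kₛ * wₜ + kₜ * wₛ + K₀ * wₛₜ = 0)
    (b0 : Q₀ * W₀ = 0) (bₛ : qₛ * W₀ + Q₀ * wₛ = 0) (bₜ : qₜ * W₀ + Q₀ * wₜ = 0)
    (bₛₛ : qₛₛ * W₀ + (2 : ℝ) • (qₛ * wₛ) + Q₀ * wₛₛ = 0) (bₜₜ : qₜₜ * W₀ + (2 : ℝ) • (qₜ * wₜ) + Q₀ * wₜₜ = 0)
    (bₛₜ : qₛₜ * W₀ + qₛ * wₜ + qₜ * wₛ + Q₀ * wₛₜ = 0)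
    (hτ : (τ * W₀).det ≠ 0) (hT : (T₀ * W₀).det ≠ 0) (hA : A₀.det ≠ 0) (hM : (kkt K₀ (fromRows Q₀ τ)).det ≠ 0) :
    mixedVar (kkt ((1 : Matrix l l ℝ) ⊗ₖ K₀) (fromRows ((1 : Matrix l l ℝ) ⊗ₖ Q₀) ((1 : Matrix l l ℝ) ⊗ₖ τ))) (kkt (c ⊗ₖ kₛ) (fromRows (c ⊗ₖ qₛ) (0 : Matrix (l × ρ) (l × ν) ℝ)))
        (kkt (c ⊗ₖ kₜ) (fromRows (c ⊗ₖ qₜ) (0 : Matrix (l × ρ) (l × ν) ℝ)))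
        (kkt ((c * c) ⊗ₖ kₛₜ) (fromRows ((c * c) ⊗ₖ qₛₜ) (0 : Matrix (l × ρ) (l × ν) ℝ)))
      + mixedVar (gram₀ ((1 : Matrix l l ℝ) ⊗ₖ W₀) (gram₀ ((1 : Matrix l l ℝ) ⊗ₖ T₀) ((1 : Matrix l l ℝ) ⊗ₖ A₀)))
          (gram₁ ((1 : Matrix l l ℝ) ⊗ₖ W₀) (c ⊗ₖ wₛ) (gram₀ ((1 : Matrix l l ℝ) ⊗ₖ T₀) ((1 : Matrix l l ℝ) ⊗ₖ A₀)) (gram₁ ((1 : Matrix l l ℝ) ⊗ₖ T₀) (c ⊗ₖ tₛ) ((1 : Matrix l l ℝ) ⊗ₖ A₀) (c ⊗ₖ Aₛ)))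
          (gram₁ ((1 : Matrix l l ℝ) ⊗ₖ W₀) (c ⊗ₖ wₜ) (gram₀ ((1 : Matrix l l ℝ) ⊗ₖ T₀) ((1 : Matrix l l ℝ) ⊗ₖ A₀)) (gram₁ ((1 : Matrix l l ℝ) ⊗ₖ T₀) (c ⊗ₖ tₜ) ((1 : Matrix l l ℝ) ⊗ₖ A₀) (c ⊗ₖ Aₜ)))
          (gramMix ((1 : Matrix l l ℝ) ⊗ₖ W₀) (c ⊗ₖ wₛ) (c ⊗ₖ wₜ) ((c * c) ⊗ₖ wₛₜ) (gram₀ ((1 : Matrix l l ℝ) ⊗ₖ T₀) ((1 : Matrix l l ℝ) ⊗ₖ A₀))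
            (gram₁ ((1 : Matrix l l ℝ) ⊗ₖ T₀) (c ⊗ₖ tₛ) ((1 : Matrix l l ℝ) ⊗ₖ A₀) (c ⊗ₖ Aₛ)) (gram₁ ((1 : Matrix l l ℝ) ⊗ₖ T₀) (c ⊗ₖ tₜ) ((1 : Matrix l l ℝ) ⊗ₖ A₀) (c ⊗ₖ Aₜ))
            (gramMix ((1 : Matrix l l ℝ) ⊗ₖ T₀) (c ⊗ₖ tₛ) (c ⊗ₖ tₜ) ((c * c) ⊗ₖ tₛₜ) ((1 : Matrix l l ℝ) ⊗ₖ A₀) (c ⊗ₖ Aₛ) (c ⊗ₖ Aₜ) ((c * c) ⊗ₖ Aₛₜ)))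
    = mixedVar (kkt ((1 : Matrix l l ℝ) ⊗ₖ K₀ + gram₀ ((1 : Matrix l l ℝ) ⊗ₖ T₀) ((1 : Matrix l l ℝ) ⊗ₖ A₀)) ((1 : Matrix l l ℝ) ⊗ₖ Q₀))
          (kkt (c ⊗ₖ kₛ + gram₁ ((1 : Matrix l l ℝ) ⊗ₖ T₀) (c ⊗ₖ tₛ) ((1 : Matrix l l ℝ) ⊗ₖ A₀) (c ⊗ₖ Aₛ)) (c ⊗ₖ qₛ))
          (kkt (c ⊗ₖ kₜ + gram₁ ((1 : Matrix l l ℝ) ⊗ₖ T₀) (c ⊗ₖ tₜ) ((1 : Matrix l l ℝ) ⊗ₖ A₀) (c ⊗ₖ Aₜ)) (c ⊗ₖ qₜ))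
          (kkt ((c * c) ⊗ₖ kₛₜ + gramMix ((1 : Matrix l l ℝ) ⊗ₖ T₀) (c ⊗ₖ tₛ) (c ⊗ₖ tₜ) ((c * c) ⊗ₖ tₛₜ) ((1 : Matrix l l ℝ) ⊗ₖ A₀) (c ⊗ₖ Aₛ) (c ⊗ₖ Aₜ) ((c * c) ⊗ₖ Aₛₜ))
            ((c * c) ⊗ₖ qₛₜ))
      + 2 * mixedVar ((1 : Matrix l l ℝ) ⊗ₖ τ * ((1 : Matrix l l ℝ) ⊗ₖ W₀)) ((1 : Matrix l l ℝ) ⊗ₖ τ * (c ⊗ₖ wₛ)) ((1 : Matrix l l ℝ) ⊗ₖ τ * (c ⊗ₖ wₜ)) ((1 : Matrix l l ℝ) ⊗ₖ τ * ((c * c) ⊗ₖ wₛₜ)) := by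
  have a0t : K₀ᵀ * W₀ = 0 := by rw [hK₀]; exact a0
  exact mixedVar_gramTransfer_jets ((1 : Matrix l l ℝ) ⊗ₖ K₀) (c ⊗ₖ kₛ) (c ⊗ₖ kₜ) ((c * c) ⊗ₖ kₛₛ) ((c * c) ⊗ₖ kₜₜ) ((c * c) ⊗ₖ kₛₜ)
    ((1 : Matrix l l ℝ) ⊗ₖ Q₀) (c ⊗ₖ qₛ) (c ⊗ₖ qₜ) ((c * c) ⊗ₖ qₛₛ) ((c * c) ⊗ₖ qₜₜ) ((c * c) ⊗ₖ qₛₜ)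
    ((1 : Matrix l l ℝ) ⊗ₖ T₀) (c ⊗ₖ tₛ) (c ⊗ₖ tₜ) ((c * c) ⊗ₖ tₛₛ) ((c * c) ⊗ₖ tₜₜ) ((c * c) ⊗ₖ tₛₜ)
    ((1 : Matrix l l ℝ) ⊗ₖ A₀) (c ⊗ₖ Aₛ) (c ⊗ₖ Aₜ) ((c * c) ⊗ₖ Aₛₛ) ((c * c) ⊗ₖ Aₜₜ) ((c * c) ⊗ₖ Aₛₜ)
    ((1 : Matrix l l ℝ) ⊗ₖ W₀) (c ⊗ₖ wₛ) (c ⊗ₖ wₜ) ((c * c) ⊗ₖ wₛₛ) ((c * c) ⊗ₖ wₜₜ) ((c * c) ⊗ₖ wₛₜ) ((1 : Matrix l l ℝ) ⊗ₖ τ)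
    (lift_rel₀ a0) (by rw [kronecker_transpose', Matrix.transpose_one]; exact lift_rel₀ a0t)
    (lift_rel₁ c aₛ) (lift_rel₁_transpose hc hK₀ hkₛ aₛ) (lift_rel₁ c aₜ) (lift_rel₁_transpose hc hK₀ hkₜ aₜ)
    (lift_rel₂ c aₛₛ) (lift_rel₂_transpose hc hK₀ hkₛ hkₛₛ aₛₛ) (lift_rel₂ c aₜₜ) (lift_rel₂_transpose hc hK₀ hkₜ hkₜₜ aₜₜ)
    (lift_rel_mix c aₛₜ) (lift_rel_mix_transpose hc hK₀ hkₛ hkₜ hkₛₜ aₛₜ)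
    (lift_rel₀ b0) (lift_rel₁ c bₛ) (lift_rel₁ c bₜ) (lift_rel₂ c bₛₛ) (lift_rel₂ c bₜₜ) (lift_rel_mix c bₛₜ)
    (det_lift_mul_ne_zero hτ) (det_lift_mul_ne_zero hT) (det_one_kronecker_ne_zero hA) (det_kkt_lift_ne_zero hM)

end Lift


/-! ## §3 The stripped (colour-free) identity: signed bordered jets and twisted Gram jets -/

section Strip

variable {l ν μ ρ : Type*} [Fintype l] [Fintype ν] [Fintype μ] [Fintype ρ] [DecidableEq l] [DecidableEq ν] [DecidableEq μ] [DecidableEq ρ]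

/-- [our object] THE SIGNED DOUBLY BORDERED FIRST JET `[[k, −[q;0]ᵀ], [[q;0], 0]]` (F-g6-1's `j = [[k,−qᵀ],[q,0]]` padded by the comb rows). -/
def tj (ρ : Type*) (k : Matrix ν ν ℝ) (q : Matrix μ ν ℝ) : Matrix (ν ⊕ (μ ⊕ ρ)) (ν ⊕ (μ ⊕ ρ)) ℝ :=
  fromBlocks k (-(fromRows q (0 : Matrix ρ ν ℝ))ᵀ) (fromRows q (0 : Matrix ρ ν ℝ)) 0

/-- [our object] THE SIGNED BORDERED FIRST JET `[[k, −qᵀ], [q, 0]]` on `ν ⊕ μ`. -/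
def tj₂ (k : Matrix ν ν ℝ) (q : Matrix μ ν ℝ) : Matrix (ν ⊕ μ) (ν ⊕ μ) ℝ := fromBlocks k (-qᵀ) q 0

variable {c : Matrix l l ℝ} (hc : cᵀ = -c)
include hc

omit [Fintype l] [Fintype ν] [Fintype μ] [Fintype ρ] [DecidableEq l] [DecidableEq ν] [DecidableEq μ] [DecidableEq ρ] in
/-- [folklore] `cᵀ = (−1)•c`. -/
theorem hc_smul : cᵀ = (-1 : ℝ) • c := by rw [neg_one_smul]; exact hc

omit [Fintype l] [Fintype ν] [Fintype μ] [Fintype ρ] [DecidableEq l] [DecidableEq ν] [DecidableEq μ] [DecidableEq ρ] in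
/-- [folklore] Lifted first M-jet = `e₃`-re-indexed `c ⊗ tj`. -/
theorem kkt_lift₁ (k : Matrix ν ν ℝ) (q : Matrix μ ν ℝ) :
    kkt (c ⊗ₖ k) (fromRows (c ⊗ₖ q) (0 : Matrix (l × ρ) (l × ν) ℝ)) = reindex (e₃ l ν μ ρ) (e₃ l ν μ ρ) (c ⊗ₖ tj ρ k q) := by
  rw [show (0 : Matrix (l × ρ) (l × ν) ℝ) = c ⊗ₖ (0 : Matrix ρ ν ℝ) by rw [Matrix.kronecker_zero], kkt_kronecker (hc_smul hc),
    neg_one_smul]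
  rfl

omit [Fintype ν] [Fintype μ] [Fintype ρ] [DecidableEq l] [DecidableEq ν] [DecidableEq μ] [DecidableEq ρ] in
/-- [folklore] Lifted second M-jet = `e₃`-re-indexed `(c·c) ⊗ kkt k [q;0]`. -/
theorem kkt_lift₂ (k : Matrix ν ν ℝ) (q : Matrix μ ν ℝ) :
    kkt ((c * c) ⊗ₖ k) (fromRows ((c * c) ⊗ₖ q) (0 : Matrix (l × ρ) (l × ν) ℝ))
      = reindex (e₃ l ν μ ρ) (e₃ l ν μ ρ) ((c * c) ⊗ₖ kkt k (fromRows q (0 : Matrix ρ ν ℝ))) := by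
  rw [show (0 : Matrix (l × ρ) (l × ν) ℝ) = (c * c) ⊗ₖ (0 : Matrix ρ ν ℝ) by rw [Matrix.kronecker_zero], kkt_kronecker_symm (sq_transpose hc)]

omit [Fintype ν] [Fintype μ] [DecidableEq ν] [DecidableEq μ] [DecidableEq ρ] in
/-- [folklore] Lifted first N-jet = `e₂`-re-indexed `c ⊗ tj₂ (k + twisted weight jet) q`. -/
theorem kktN_lift₁ (k : Matrix ν ν ℝ) (q : Matrix μ ν ℝ) (T₀ t : Matrix ρ ν ℝ) (A₀ a : Matrix ρ ρ ℝ) :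
    kkt (c ⊗ₖ k + gram₁ ((1 : Matrix l l ℝ) ⊗ₖ T₀) (c ⊗ₖ t) ((1 : Matrix l l ℝ) ⊗ₖ A₀) (c ⊗ₖ a)) (c ⊗ₖ q)
      = reindex (e₂ l ν μ) (e₂ l ν μ) (c ⊗ₖ tj₂ (k + tgram₁ T₀ t A₀ a) q) := by
  rw [gram₁_lift hc, ← Matrix.kronecker_add, kkt_kronecker₂ (hc_smul hc), neg_one_smul]
  rfl

omit [Fintype ν] [Fintype μ] [DecidableEq ν] [DecidableEq μ] [DecidableEq ρ] in
/-- [folklore] Lifted mixed N-jet = `e₂`-re-indexed `(c·c) ⊗ kkt (kₛₜ + twisted mixed weight jet) qₛₜ`. -/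
theorem kktN_lift₂ (k : Matrix ν ν ℝ) (q : Matrix μ ν ℝ) (T₀ tₛ tₜ tₛₜ : Matrix ρ ν ℝ) (A₀ Aₛ Aₜ Aₛₜ : Matrix ρ ρ ℝ) :
    kkt ((c * c) ⊗ₖ k + gramMix ((1 : Matrix l l ℝ) ⊗ₖ T₀) (c ⊗ₖ tₛ) (c ⊗ₖ tₜ) ((c * c) ⊗ₖ tₛₜ)
        ((1 : Matrix l l ℝ) ⊗ₖ A₀) (c ⊗ₖ Aₛ) (c ⊗ₖ Aₜ) ((c * c) ⊗ₖ Aₛₜ)) ((c * c) ⊗ₖ q)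
      = reindex (e₂ l ν μ) (e₂ l ν μ) ((c * c) ⊗ₖ kkt (k + tgramMix T₀ tₛ tₜ tₛₜ A₀ Aₛ Aₜ Aₛₜ) q) := by
  rw [gramMix_lift hc, ← Matrix.kronecker_add, kkt_kronecker₂_symm (sq_transpose hc)]

end Strip


section StripMain

variable {l ν μ ρ : Type*} [Fintype l] [Fintype ν] [Fintype μ] [Fintype ρ] [DecidableEq l] [DecidableEq ν] [DecidableEq μ] [DecidableEq ρ]
variable {c : Matrix l l ℝ}

omit [Fintype ν] [Fintype μ] [DecidableEq ν] [DecidableEq μ] [DecidableEq ρ] in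
/-- [folklore] Lifted zeroth N-matrix = `e₂`-re-indexed `1 ⊗ kkt (K₀ + B₀) Q₀`. -/
theorem kktN_lift₀ (K₀ : Matrix ν ν ℝ) (Q₀ : Matrix μ ν ℝ) (T₀ : Matrix ρ ν ℝ) (A₀ : Matrix ρ ρ ℝ) :
    kkt ((1 : Matrix l l ℝ) ⊗ₖ K₀ + gram₀ ((1 : Matrix l l ℝ) ⊗ₖ T₀) ((1 : Matrix l l ℝ) ⊗ₖ A₀)) ((1 : Matrix l l ℝ) ⊗ₖ Q₀)
      = reindex (e₂ l ν μ) (e₂ l ν μ) ((1 : Matrix l l ℝ) ⊗ₖ kkt (K₀ + gram₀ T₀ A₀) Q₀) := by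
  rw [gram₀_lift, ← Matrix.kronecker_add, kkt_kronecker₂_symm Matrix.transpose_one]

omit [DecidableEq ν] [DecidableEq μ] [DecidableEq ρ] [Fintype μ] in
/-- [folklore] Lifted FP Gram, zeroth. -/
theorem gramPhi_lift₀ (W₀ : Matrix ν ρ ℝ) (T₀ : Matrix ρ ν ℝ) (A₀ : Matrix ρ ρ ℝ) :
    gram₀ ((1 : Matrix l l ℝ) ⊗ₖ W₀) (gram₀ ((1 : Matrix l l ℝ) ⊗ₖ T₀) ((1 : Matrix l l ℝ) ⊗ₖ A₀))
      = (1 : Matrix l l ℝ) ⊗ₖ gram₀ W₀ (gram₀ T₀ A₀) := by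
  rw [gram₀_lift, gram₀_lift]

omit [DecidableEq ν] [DecidableEq μ] [DecidableEq ρ] [Fintype μ] in
/-- [folklore] Lifted FP Gram, first (twisted). -/
theorem gramPhi_lift₁ (hc : cᵀ = -c) (W₀ w : Matrix ν ρ ℝ) (T₀ t : Matrix ρ ν ℝ) (A₀ a : Matrix ρ ρ ℝ) :
    gram₁ ((1 : Matrix l l ℝ) ⊗ₖ W₀) (c ⊗ₖ w) (gram₀ ((1 : Matrix l l ℝ) ⊗ₖ T₀) ((1 : Matrix l l ℝ) ⊗ₖ A₀))
        (gram₁ ((1 : Matrix l l ℝ) ⊗ₖ T₀) (c ⊗ₖ t) ((1 : Matrix l l ℝ) ⊗ₖ A₀) (c ⊗ₖ a))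
      = c ⊗ₖ tgram₁ W₀ w (gram₀ T₀ A₀) (tgram₁ T₀ t A₀ a) := by
  rw [gram₀_lift, gram₁_lift hc, gram₁_lift hc]

omit [DecidableEq ν] [DecidableEq μ] [DecidableEq ρ] [Fintype μ] in
/-- [folklore] Lifted FP Gram, mixed (twisted). -/
theorem gramPhi_liftMix (hc : cᵀ = -c) (W₀ wₛ wₜ wₛₜ : Matrix ν ρ ℝ) (T₀ tₛ tₜ tₛₜ : Matrix ρ ν ℝ) (A₀ Aₛ Aₜ Aₛₜ : Matrix ρ ρ ℝ) :
    gramMix ((1 : Matrix l l ℝ) ⊗ₖ W₀) (c ⊗ₖ wₛ) (c ⊗ₖ wₜ) ((c * c) ⊗ₖ wₛₜ) (gram₀ ((1 : Matrix l l ℝ) ⊗ₖ T₀) ((1 : Matrix l l ℝ) ⊗ₖ A₀))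
        (gram₁ ((1 : Matrix l l ℝ) ⊗ₖ T₀) (c ⊗ₖ tₛ) ((1 : Matrix l l ℝ) ⊗ₖ A₀) (c ⊗ₖ Aₛ))
        (gram₁ ((1 : Matrix l l ℝ) ⊗ₖ T₀) (c ⊗ₖ tₜ) ((1 : Matrix l l ℝ) ⊗ₖ A₀) (c ⊗ₖ Aₜ))
        (gramMix ((1 : Matrix l l ℝ) ⊗ₖ T₀) (c ⊗ₖ tₛ) (c ⊗ₖ tₜ) ((c * c) ⊗ₖ tₛₜ) ((1 : Matrix l l ℝ) ⊗ₖ A₀) (c ⊗ₖ Aₛ) (c ⊗ₖ Aₜ) ((c * c) ⊗ₖ Aₛₜ))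
      = (c * c) ⊗ₖ tgramMix W₀ wₛ wₜ wₛₜ (gram₀ T₀ A₀) (tgram₁ T₀ tₛ A₀ Aₛ) (tgram₁ T₀ tₜ A₀ Aₜ) (tgramMix T₀ tₛ tₜ tₛₜ A₀ Aₛ Aₜ Aₛₜ) := by
  rw [gram₀_lift, gram₁_lift hc, gram₁_lift hc, gramMix_lift hc, gramMix_lift hc]

omit [Fintype μ] [Fintype ρ] [DecidableEq ν] [DecidableEq μ] [DecidableEq ρ] in
/-- [folklore] Lifted comb Gram factors: `(1⊗τ)(c′⊗w) = c′ ⊗ (τw)`. -/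
theorem lift_mul (c' : Matrix l l ℝ) (τ : Matrix ρ ν ℝ) (w : Matrix ν ρ ℝ) :
    ((1 : Matrix l l ℝ) ⊗ₖ τ) * (c' ⊗ₖ w) = c' ⊗ₖ (τ * w) := by
  rw [← Matrix.mul_kronecker_mul, Matrix.one_mul]

/-- [folklore] **THE STRIPPED IDENTITY, UP TO THE COLOUR FACTOR `tr(c·c)`** (any antisymmetric `c`): the colourless one-sided letters +
parity types + four `det ≠ 0` give
`tr(c·c)·[mixedVar M (tj kₛ qₛ) (tj kₜ qₜ) (kkt kₛₜ [qₛₜ;0]) + mixedVar Φ₀ (twisted Φ-jets)] = tr(c·c)·[mixedVar N₀ (tj₂ …) (tj₂ …) (kkt …) + 2·mixedVar (τW₀) (τwₛ) (τwₜ) (τwₛₜ)]`. -/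
theorem mixedVar_gramTransfer_stripped_mul (hc : cᵀ = -c)
    (K₀ kₛ kₜ kₛₛ kₜₜ kₛₜ : Matrix ν ν ℝ) (Q₀ qₛ qₜ qₛₛ qₜₜ qₛₜ : Matrix μ ν ℝ)
    (T₀ tₛ tₜ tₛₛ tₜₜ tₛₜ : Matrix ρ ν ℝ) (A₀ Aₛ Aₜ Aₛₛ Aₜₜ Aₛₜ : Matrix ρ ρ ℝ) (W₀ wₛ wₜ wₛₛ wₜₜ wₛₜ : Matrix ν ρ ℝ) (τ : Matrix ρ ν ℝ)
    (hK₀ : K₀ᵀ = K₀) (hkₛ : kₛᵀ = -kₛ) (hkₜ : kₜᵀ = -kₜ) (hkₛₛ : kₛₛᵀ = kₛₛ) (hkₜₜ : kₜₜᵀ = kₜₜ) (hkₛₜ : kₛₜᵀ = kₛₜ)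
    (a0 : K₀ * W₀ = 0) (aₛ : kₛ * W₀ + K₀ * wₛ = 0) (aₜ : kₜ * W₀ + K₀ * wₜ = 0)
    (aₛₛ : kₛₛ * W₀ + (2 : ℝ) • (kₛ * wₛ) + K₀ * wₛₛ = 0) (aₜₜ : kₜₜ * W₀ + (2 : ℝ) • (kₜ * wₜ) + K₀ * wₜₜ = 0)
    (aₛₜ : kₛₜ * W₀ + kₛ * wₜ + kₜ * wₛ + K₀ * wₛₜ = 0)
    (b0 : Q₀ * W₀ = 0) (bₛ : qₛ * W₀ + Q₀ * wₛ = 0) (bₜ : qₜ * W₀ + Q₀ * wₜ = 0)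
    (bₛₛ : qₛₛ * W₀ + (2 : ℝ) • (qₛ * wₛ) + Q₀ * wₛₛ = 0) (bₜₜ : qₜₜ * W₀ + (2 : ℝ) • (qₜ * wₜ) + Q₀ * wₜₜ = 0)
    (bₛₜ : qₛₜ * W₀ + qₛ * wₜ + qₜ * wₛ + Q₀ * wₛₜ = 0)
    (hτ : (τ * W₀).det ≠ 0) (hT : (T₀ * W₀).det ≠ 0) (hA : A₀.det ≠ 0) (hM : (kkt K₀ (fromRows Q₀ τ)).det ≠ 0) :
    (c * c).trace * (mixedVar (kkt K₀ (fromRows Q₀ τ)) (tj ρ kₛ qₛ) (tj ρ kₜ qₜ) (kkt kₛₜ (fromRows qₛₜ (0 : Matrix ρ ν ℝ)))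
        + mixedVar (gram₀ W₀ (gram₀ T₀ A₀)) (tgram₁ W₀ wₛ (gram₀ T₀ A₀) (tgram₁ T₀ tₛ A₀ Aₛ)) (tgram₁ W₀ wₜ (gram₀ T₀ A₀) (tgram₁ T₀ tₜ A₀ Aₜ))
            (tgramMix W₀ wₛ wₜ wₛₜ (gram₀ T₀ A₀) (tgram₁ T₀ tₛ A₀ Aₛ) (tgram₁ T₀ tₜ A₀ Aₜ) (tgramMix T₀ tₛ tₜ tₛₜ A₀ Aₛ Aₜ Aₛₜ)))
    = (c * c).trace * (mixedVar (kkt (K₀ + gram₀ T₀ A₀) Q₀) (tj₂ (kₛ + tgram₁ T₀ tₛ A₀ Aₛ) qₛ) (tj₂ (kₜ + tgram₁ T₀ tₜ A₀ Aₜ) qₜ)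
          (kkt (kₛₜ + tgramMix T₀ tₛ tₜ tₛₜ A₀ Aₛ Aₜ Aₛₜ) qₛₜ)
        + 2 * mixedVar (τ * W₀) (τ * wₛ) (τ * wₜ) (τ * wₛₜ)) := by
  have h := mixedVar_gramTransfer_lift hc K₀ kₛ kₜ kₛₛ kₜₜ kₛₜ Q₀ qₛ qₜ qₛₛ qₜₜ qₛₜ T₀ tₛ tₜ tₛₛ tₜₜ tₛₜ A₀ Aₛ Aₜ Aₛₛ Aₜₜ Aₛₜ
    W₀ wₛ wₜ wₛₛ wₜₜ wₛₜ τ hK₀ hkₛ hkₜ hkₛₛ hkₜₜ hkₛₜ a0 aₛ aₜ aₛₛ aₜₜ aₛₜ b0 bₛ bₜ bₛₛ bₜₜ bₛₜ hτ hT hA hM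
  rw [kkt_kronecker_symm Matrix.transpose_one, kkt_lift₁ hc, kkt_lift₁ hc, kkt_lift₂ hc, mixedVar_reindex, mixedVar_kronecker_lift,
    kktN_lift₀, kktN_lift₁ hc, kktN_lift₁ hc, kktN_lift₂ hc, mixedVar_reindex, mixedVar_kronecker_lift,
    gramPhi_lift₀, gramPhi_lift₁ hc, gramPhi_lift₁ hc, gramPhi_liftMix hc, mixedVar_kronecker_lift,
    lift_mul, lift_mul, lift_mul, lift_mul, mixedVar_kronecker_lift] at h
  linear_combination h

/-- [folklore] **K-TA4C — THE COLOUR-STRIPPED GRAM-FORM JET IDENTITY** (`c = cgen`, `tr(C²) = −2` cancelled): for COLOURLESS typed data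
(`K₀` symmetric, first form jets antisymmetric, second form jets symmetric) satisfying ONLY the colourless ONE-SIDED Ward letters and the four
`det ≠ 0`:  `mixedVar M (tj kₛ qₛ) (tj kₜ qₜ) (kkt kₛₜ [qₛₜ;0]) + mixedVar Φ₀ (tgram₁ …ₛ) (tgram₁ …ₜ) (tgramMix …)
= mixedVar N₀ (tj₂ (kₛ + b̃ₛ) qₛ) (tj₂ (kₜ + b̃ₜ) qₜ) (kkt (kₛₜ + b̃ₛₜ) qₛₜ) + 2·mixedVar (τW₀) (τwₛ) (τwₜ) (τwₛₜ)` — signed first jets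
`[[k, −qᵀ],[q, 0]]`, untwisted second jets, twisted weight jets `b̃ = tgram τ′ A` and twisted FP Gram jets. -/
theorem mixedVar_gramTransfer_stripped
    (K₀ kₛ kₜ kₛₛ kₜₜ kₛₜ : Matrix ν ν ℝ) (Q₀ qₛ qₜ qₛₛ qₜₜ qₛₜ : Matrix μ ν ℝ)
    (T₀ tₛ tₜ tₛₛ tₜₜ tₛₜ : Matrix ρ ν ℝ) (A₀ Aₛ Aₜ Aₛₛ Aₜₜ Aₛₜ : Matrix ρ ρ ℝ) (W₀ wₛ wₜ wₛₛ wₜₜ wₛₜ : Matrix ν ρ ℝ) (τ : Matrix ρ ν ℝ)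
    (hK₀ : K₀ᵀ = K₀) (hkₛ : kₛᵀ = -kₛ) (hkₜ : kₜᵀ = -kₜ) (hkₛₛ : kₛₛᵀ = kₛₛ) (hkₜₜ : kₜₜᵀ = kₜₜ) (hkₛₜ : kₛₜᵀ = kₛₜ)
    (a0 : K₀ * W₀ = 0) (aₛ : kₛ * W₀ + K₀ * wₛ = 0) (aₜ : kₜ * W₀ + K₀ * wₜ = 0)
    (aₛₛ : kₛₛ * W₀ + (2 : ℝ) • (kₛ * wₛ) + K₀ * wₛₛ = 0) (aₜₜ : kₜₜ * W₀ + (2 : ℝ) • (kₜ * wₜ) + K₀ * wₜₜ = 0)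
    (aₛₜ : kₛₜ * W₀ + kₛ * wₜ + kₜ * wₛ + K₀ * wₛₜ = 0)
    (b0 : Q₀ * W₀ = 0) (bₛ : qₛ * W₀ + Q₀ * wₛ = 0) (bₜ : qₜ * W₀ + Q₀ * wₜ = 0)
    (bₛₛ : qₛₛ * W₀ + (2 : ℝ) • (qₛ * wₛ) + Q₀ * wₛₛ = 0) (bₜₜ : qₜₜ * W₀ + (2 : ℝ) • (qₜ * wₜ) + Q₀ * wₜₜ = 0)
    (bₛₜ : qₛₜ * W₀ + qₛ * wₜ + qₜ * wₛ + Q₀ * wₛₜ = 0)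
    (hτ : (τ * W₀).det ≠ 0) (hT : (T₀ * W₀).det ≠ 0) (hA : A₀.det ≠ 0) (hM : (kkt K₀ (fromRows Q₀ τ)).det ≠ 0) :
    mixedVar (kkt K₀ (fromRows Q₀ τ)) (tj ρ kₛ qₛ) (tj ρ kₜ qₜ) (kkt kₛₜ (fromRows qₛₜ (0 : Matrix ρ ν ℝ)))
      + mixedVar (gram₀ W₀ (gram₀ T₀ A₀)) (tgram₁ W₀ wₛ (gram₀ T₀ A₀) (tgram₁ T₀ tₛ A₀ Aₛ)) (tgram₁ W₀ wₜ (gram₀ T₀ A₀) (tgram₁ T₀ tₜ A₀ Aₜ))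
          (tgramMix W₀ wₛ wₜ wₛₜ (gram₀ T₀ A₀) (tgram₁ T₀ tₛ A₀ Aₛ) (tgram₁ T₀ tₜ A₀ Aₜ) (tgramMix T₀ tₛ tₜ tₛₜ A₀ Aₛ Aₜ Aₛₜ))
    = mixedVar (kkt (K₀ + gram₀ T₀ A₀) Q₀) (tj₂ (kₛ + tgram₁ T₀ tₛ A₀ Aₛ) qₛ) (tj₂ (kₜ + tgram₁ T₀ tₜ A₀ Aₜ) qₜ)
          (kkt (kₛₜ + tgramMix T₀ tₛ tₜ tₛₜ A₀ Aₛ Aₜ Aₛₜ) qₛₜ)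
      + 2 * mixedVar (τ * W₀) (τ * wₛ) (τ * wₜ) (τ * wₛₜ) := by
  have h := mixedVar_gramTransfer_stripped_mul cgen_transpose K₀ kₛ kₜ kₛₛ kₜₜ kₛₜ Q₀ qₛ qₜ qₛₛ qₜₜ qₛₜ T₀ tₛ tₜ tₛₛ tₜₜ tₛₜ
    A₀ Aₛ Aₜ Aₛₛ Aₜₜ Aₛₜ W₀ wₛ wₜ wₛₛ wₜₜ wₛₜ τ hK₀ hkₛ hkₜ hkₛₛ hkₜₜ hkₛₜ a0 aₛ aₜ aₛₛ aₜₜ aₛₜ b0 bₛ bₜ bₛₛ bₜₜ bₛₜ hτ hT hA hM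
  rw [trace_cgen_mul_cgen] at h
  linarith

end StripMain

end Summit.QuantumFields.BalabanUV.Beta.D1BFx.GramWeightColourLift

end
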